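import Summits.Parity.GeneralizedHardyLittlewood.Theorems.BeyondDiagonalBeatsQuarter.OffDiagPrincipalShortClosedForm
import Summits.Parity.GeneralizedHardyLittlewood.Theorems.BeyondDiagonalBeatsQuarter.OffDiagDyadic
import Mathlib.Analysis.Calculus.ContDiff.RCLike
import HarnessLib

/-!
# Route `PrimeLevelFamEdge`, crux K_B (stmt-Parity-20343), line `diagonal_kernel_split` rev 4, plan Ω,
# OMEGA-BLUEPRINT v4 §3c — **C1 over a WINDOW DECOMPOSITION of the product variable**
# (input I2a of the a8P-closable total, worker-3 sizing S 17:27Z / 17:43Z)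

The Mellin-bump lemma (`MellinBump.mellinBump_xsq_bv`, complex form `OffDiag.mellinBump_xsq_e_complex`) bounds
`Σ_{m₁,m₂≤M} (x_{m₁}/m₁)(x_{m₂}/m₂)·G(m₁m₂/Y)·e(Θ·m₁m₂/Y)` by `D·X(K,B,Θ)/(1 + log Y)^A` for a window `G` supported
in a FIXED interval `[a,b] ⊂ [a₀,∞)` (the constant `D` depends on `a₀`). The sample weights of the a8P-short bound
(the box transform as a function of `u = lm/(d₁d₂)`) are NOT so supported: `lm` runs over `[1, M²]`. This file
cuts the product variable into windows: for a profile `ρ` (`|ρ| ≤ 1`, `K_ρ`-Lipschitz, supported in `[a,b]`, `a > 0`)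
and scales `λ_j` with `Σ_j ρ(y/λ_j) = 1` wherever `G(y) ≠ 0` is sampled, the sum splits into the windows
`h_j(s) = ρ(s)·G(λ_j s)` read at scale `Y_j = Y·λ_j` with `Θ_j = Θ·λ_j` turns, and each window is fed to C1:

* §1 `lipschitz_ofReal_mul_window` — `ρ·G` is `(K_ρ·B + K)`-Lipschitz GLOBALLY from the sup `B` and the Lipschitz
  constant `K` of `G` on the window `[a,b]` ONLY;
* §2 **`norm_sum_xsq_windows_le`** — the windowed C1 bound
  `‖Σ (x/m₁)(x/m₂)·G(m₁m₂/Y)·e(Θm₁m₂/Y)‖ ≤ Σ_{j∈J} D·X(K_ρB_j + λ_jK_j, B_j, Θλ_j; Y_j = Yλ_j)/(1 + log(Yλ_j))^A`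
  with per-window data (`B_j` = sup, `K_j` = Lipschitz constant of `G` on `[λ_j a, λ_j b]`) as hypotheses, `Yλ_j ≥ 1`;
* §3 `exists_lipschitz_dyadicBump`, **`norm_sum_xsq_dyadicWindows_le`** — the dyadic instance `ρ = θ` (`dyadicBump`,
  support `(1/2, 2)`), `λ_j = 2^j/Y`, `j < N` with `⌊M⌋² ≤ 2^N/2` (partition `sum_range_dyadicBump_div_two_pow`):
  `Y_j = 2^j`, so the gain of window `j` is `(1 + j·log 2)^{−A}` — VOID for small `j`, which is harmless exactly when
  the window sups `B_j` decay geometrically downwards (for the box transform `|J₁(z)| ≤ z/2` gives `B_j ∝ 2^{j/2}`: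
  input I1, prover-5's `OffDiagBoxTransformRegularity`; the geometric bookkeeping is the consumer's).

Theorems only; standard axioms. Helper toward `stub_offDiagBelowSlack_io`; closes nothing.
«The programme SEARCHES and TYPES; no claim about Landau–Siegel zeros, Theorems 1–2 of arXiv:2211.02515 or
a repaired Margin232 until a kernel theorem says so.»
-/

noncomputable section

open Real Complex Finset
open scoped FourierTransform

namespace Summit.Parity.GeneralizedHardyLittlewood.Theorems.BeyondDiagonalBeatsQuarter.OffDiag

open Literature.Analysis.Calculus.WhitneyConvex (dyadicBump dyadicBump_nonneg dyadicBump_le_one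
  mem_Ioo_of_dyadicBump_ne_zero contDiff_dyadicBump)
open KernelFormXSq (xsq)

/-! ### §1. A window times a locally controlled weight is globally Lipschitz -/

/-- **Window × weight.** If `ρ : ℝ → ℝ` is `K_ρ`-Lipschitz, `|ρ| ≤ 1`, supported in `[a,b]`, and `G : ℝ → ℂ` has
`‖G‖ ≤ B` and Lipschitz constant `K` ON `[a,b]` (nothing assumed outside), then `s ↦ ρ(s)·G(s)` is
`(K_ρ·B + K)`-Lipschitz on all of `ℝ`. [folklore] -/
theorem lipschitz_ofReal_mul_window {ρ : ℝ → ℝ} {G : ℝ → ℂ} {a b Kρ K B : ℝ}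
    (hρLip : ∀ x y, |ρ x - ρ y| ≤ Kρ * |x - y|) (hρsupp : ∀ y, ρ y ≠ 0 → a ≤ y ∧ y ≤ b)
    (hρ1 : ∀ y, |ρ y| ≤ 1) (hKρ : 0 ≤ Kρ) (hK : 0 ≤ K) (hB : 0 ≤ B)
    (hGB : ∀ y, a ≤ y → y ≤ b → ‖G y‖ ≤ B)
    (hGLip : ∀ x y, a ≤ x → x ≤ b → a ≤ y → y ≤ b → ‖G x - G y‖ ≤ K * |x - y|) (x y : ℝ) :
    ‖(ρ x : ℂ) * G x - (ρ y : ℂ) * G y‖ ≤ (Kρ * B + K) * |x - y| := by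
  have htot : 0 ≤ (Kρ * B + K) * |x - y| := by positivity
  -- zero outside the window
  have hout : ∀ z, ¬ (a ≤ z ∧ z ≤ b) → ρ z = 0 := fun z hz ↦ by
    by_contra h; exact hz (hρsupp z h)
  by_cases hx : a ≤ x ∧ x ≤ b
  · by_cases hy : a ≤ y ∧ y ≤ b
    · -- both inside
      have hsplit : (ρ x : ℂ) * G x - (ρ y : ℂ) * G y = ((ρ x - ρ y : ℝ) : ℂ) * G x + (ρ y : ℂ) * (G x - G y) := by
        push_cast; ring
      rw [hsplit]
      refine (norm_add_le _ _).trans ?_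
      rw [norm_mul, norm_mul, Complex.norm_real, Complex.norm_real, Real.norm_eq_abs, Real.norm_eq_abs]
      calc |ρ x - ρ y| * ‖G x‖ + |ρ y| * ‖G x - G y‖
          ≤ Kρ * |x - y| * B + 1 * (K * |x - y|) :=
            add_le_add (mul_le_mul (hρLip x y) (hGB x hx.1 hx.2) (norm_nonneg _) (by positivity))
              (mul_le_mul (hρ1 y) (hGLip x y hx.1 hx.2 hy.1 hy.2) (norm_nonneg _) zero_le_one)
        _ = (Kρ * B + K) * |x - y| := by ring
    · -- x inside, y outside
      rw [hout y hy, Complex.ofReal_zero, zero_mul, sub_zero, norm_mul, Complex.norm_real, Real.norm_eq_abs]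
      have h1 : |ρ x| = |ρ x - ρ y| := by rw [hout y hy, sub_zero]
      rw [h1]
      calc |ρ x - ρ y| * ‖G x‖ ≤ Kρ * |x - y| * B :=
            mul_le_mul (hρLip x y) (hGB x hx.1 hx.2) (norm_nonneg _) (by positivity)
        _ ≤ (Kρ * B + K) * |x - y| := by nlinarith [abs_nonneg (x - y)]
  · by_cases hy : a ≤ y ∧ y ≤ b
    · -- x outside, y inside
      rw [hout x hx, Complex.ofReal_zero, zero_mul, zero_sub, norm_neg, norm_mul, Complex.norm_real,
        Real.norm_eq_abs]
      have h1 : |ρ y| = |ρ x - ρ y| := by rw [hout x hx, zero_sub, abs_neg]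
      rw [h1]
      calc |ρ x - ρ y| * ‖G y‖ ≤ Kρ * |x - y| * B :=
            mul_le_mul (hρLip x y) (hGB y hy.1 hy.2) (norm_nonneg _) (by positivity)
        _ ≤ (Kρ * B + K) * |x - y| := by nlinarith [abs_nonneg (x - y)]
    · -- both outside
      rw [hout x hx, hout y hy]
      simpa using htot

/-! ### §2. The windowed C1 bound -/

/-- **C1 over a window decomposition (generic profile and scales).** For a profile `ρ` (`K_ρ`-Lipschitz, `|ρ| ≤ 1`,
supported in `[a,b]` with `0 < a`), a finite set of scales `λ_j > 0` with `Y·λ_j ≥ 1` forming a partition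
`Σ_{j∈J} ρ((m₁m₂/Y)/λ_j) = 1` at every sampled product where `G ≠ 0`, and per-window data `B_j ≥ ‖G‖`,
`K_j ≥ Lip(G)` on `[λ_j a, λ_j b]`:
`‖Σ_{m₁,m₂≤M} (x_{m₁}/m₁)(x_{m₂}/m₂)·G(m₁m₂/Y)·e(Θm₁m₂/Y)‖ ≤ Σ_{j∈J} D·X_j/(1 + log(Yλ_j))^A`,
`X_j = (2B_j + (K′_j + 2π|Θλ_j|B_j)(b − a))(1 + |log b|) + 2(K′_j + 2π|Θλ_j|B_j)·√(b·Yλ_j)/(Yλ_j)`, `K′_j = K_ρB_j + λ_jK_j`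
(window `j` is `h_j(s) = ρ(s)·G(λ_j s)` at scale `Y_j = Yλ_j` with `Θ_j = Θλ_j` turns; `mellinBump_xsq_e_complex` per window).
[cite: KowalskiMichelVanderKam2000, Prop. 5.1 p. 18 — derivation; MontgomeryVaughan2007, §8.1 (8.6)] -/
theorem norm_sum_xsq_windows_le (A : ℕ) {a : ℝ} (ha : 0 < a) :
    ∃ D : ℝ, 0 < D ∧ ∀ {ι : Type} (J : Finset ι) (lam : ι → ℝ) (b Kρ : ℝ) (ρ : ℝ → ℝ), a ≤ b → 0 ≤ Kρ →
      (∀ x y, |ρ x - ρ y| ≤ Kρ * |x - y|) → (∀ y, ρ y ≠ 0 → a ≤ y ∧ y ≤ b) → (∀ y, |ρ y| ≤ 1) →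
      ∀ (G : ℝ → ℂ) (Θ M Y : ℝ), 1 < M → 0 < Y → (∀ j ∈ J, 0 < lam j ∧ 1 ≤ Y * lam j) →
      (∀ m₁ ∈ Icc 1 ⌊M⌋₊, ∀ m₂ ∈ Icc 1 ⌊M⌋₊, G ((m₁ : ℝ) * m₂ / Y) ≠ 0 →
        ∑ j ∈ J, ρ ((m₁ : ℝ) * m₂ / Y / lam j) = 1) →
      ∀ (B K : ι → ℝ), (∀ j ∈ J, 0 ≤ B j ∧ 0 ≤ K j) →
      (∀ j ∈ J, ∀ y, lam j * a ≤ y → y ≤ lam j * b → ‖G y‖ ≤ B j) →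
      (∀ j ∈ J, ∀ x y, lam j * a ≤ x → x ≤ lam j * b → lam j * a ≤ y → y ≤ lam j * b →
        ‖G x - G y‖ ≤ K j * |x - y|) →
        ‖∑ m₁ ∈ Icc 1 ⌊M⌋₊, ∑ m₂ ∈ Icc 1 ⌊M⌋₊,
            ((xsq M m₁ / m₁ * (xsq M m₂ / m₂) : ℝ) : ℂ) * G ((m₁ : ℝ) * m₂ / Y) *
              (𝐞 (Θ * ((m₁ : ℝ) * m₂ / Y)) : ℂ)‖ ≤
          ∑ j ∈ J, D * ((2 * B j + ((Kρ * B j + lam j * K j) + 2 * π * |Θ * lam j| * B j) * (b - a)) *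
              (1 + |Real.log b|) +
            2 * ((Kρ * B j + lam j * K j) + 2 * π * |Θ * lam j| * B j) * (Real.sqrt (b * (Y * lam j)) / (Y * lam j))) /
            (1 + Real.log (Y * lam j)) ^ A := by
  obtain ⟨D, hD, hmain⟩ := mellinBump_xsq_e_complex A ha
  refine ⟨D, hD, ?_⟩
  intro ι J lam b Kρ ρ hab hKρ hρLip hρsupp hρ1 G Θ M Y hM hY hlam hpart B K hBK hGB hGLip
  -- the windows
  set h : ι → ℝ → ℂ := fun j s ↦ (ρ s : ℂ) * G (lam j * s) with hh
  -- Step 1: split the sum into windows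
  have hsplit : ∑ m₁ ∈ Icc 1 ⌊M⌋₊, ∑ m₂ ∈ Icc 1 ⌊M⌋₊,
      ((xsq M m₁ / m₁ * (xsq M m₂ / m₂) : ℝ) : ℂ) * G ((m₁ : ℝ) * m₂ / Y) * (𝐞 (Θ * ((m₁ : ℝ) * m₂ / Y)) : ℂ) =
      ∑ j ∈ J, ∑ m₁ ∈ Icc 1 ⌊M⌋₊, ∑ m₂ ∈ Icc 1 ⌊M⌋₊,
        ((xsq M m₁ / m₁ * (xsq M m₂ / m₂) : ℝ) : ℂ) * h j ((m₁ : ℝ) * m₂ / (Y * lam j)) *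
          (𝐞 ((Θ * lam j) * ((m₁ : ℝ) * m₂ / (Y * lam j))) : ℂ) := by
    symm
    refine (Finset.sum_comm.trans (Finset.sum_congr rfl fun m₁ _ ↦ Finset.sum_comm)).trans ?_
    refine Finset.sum_congr rfl fun m₁ hm₁ ↦ Finset.sum_congr rfl fun m₂ hm₂ ↦ ?_
    -- per term: G y = Σ_j ρ(y/λ_j) G y, then rescale
    have hterm : ∀ j ∈ J, ((xsq M m₁ / m₁ * (xsq M m₂ / m₂) : ℝ) : ℂ) * h j ((m₁ : ℝ) * m₂ / (Y * lam j)) *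
        (𝐞 ((Θ * lam j) * ((m₁ : ℝ) * m₂ / (Y * lam j))) : ℂ) =
        (ρ ((m₁ : ℝ) * m₂ / Y / lam j) : ℂ) * (((xsq M m₁ / m₁ * (xsq M m₂ / m₂) : ℝ) : ℂ) *
          G ((m₁ : ℝ) * m₂ / Y) * (𝐞 (Θ * ((m₁ : ℝ) * m₂ / Y)) : ℂ)) := by
      intro j hj
      have hl : lam j ≠ 0 := (hlam j hj).1.ne'
      have e1 : (m₁ : ℝ) * m₂ / (Y * lam j) = (m₁ : ℝ) * m₂ / Y / lam j := by rw [div_div]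
      have e2 : lam j * ((m₁ : ℝ) * m₂ / (Y * lam j)) = (m₁ : ℝ) * m₂ / Y := by field_simp
      have e3 : (Θ * lam j) * ((m₁ : ℝ) * m₂ / (Y * lam j)) = Θ * ((m₁ : ℝ) * m₂ / Y) := by field_simp
      simp only [hh, e2, e3]
      rw [e1]
      ring
    rw [Finset.sum_congr rfl hterm, ← Finset.sum_mul]
    by_cases hG : G ((m₁ : ℝ) * m₂ / Y) = 0
    · simp [hG]
    · have hp := hpart m₁ hm₁ m₂ hm₂ hG
      have hpc : ∑ j ∈ J, (ρ ((m₁ : ℝ) * m₂ / Y / lam j) : ℂ) = 1 := by exact_mod_cast hp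
      rw [hpc, one_mul]
  rw [hsplit]
  refine (norm_sum_le _ _).trans (Finset.sum_le_sum fun j hj ↦ ?_)
  -- Step 2: C1 on window `j`
  obtain ⟨hl0, hYl⟩ := hlam j hj
  obtain ⟨hB0, hK0⟩ := hBK j hj
  have hwin : ∀ s, a ≤ s → s ≤ b → lam j * a ≤ lam j * s ∧ lam j * s ≤ lam j * b := fun s h1 h2 ↦
    ⟨mul_le_mul_of_nonneg_left h1 hl0.le, mul_le_mul_of_nonneg_left h2 hl0.le⟩
  have hLip : ∀ x y, ‖h j x - h j y‖ ≤ (Kρ * B j + lam j * K j) * |x - y| := by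
    intro x y
    refine lipschitz_ofReal_mul_window (G := fun s ↦ G (lam j * s)) hρLip hρsupp hρ1 hKρ
      (mul_nonneg hl0.le hK0) hB0
      (fun s h1 h2 ↦ hGB j hj _ (hwin s h1 h2).1 (hwin s h1 h2).2) ?_ x y
    intro x' y' hx1 hx2 hy1 hy2
    have h := hGLip j hj (lam j * x') (lam j * y') (hwin x' hx1 hx2).1 (hwin x' hx1 hx2).2
      (hwin y' hy1 hy2).1 (hwin y' hy1 hy2).2
    rw [← mul_sub, abs_mul, abs_of_pos hl0] at h
    linarith [h]
  have hsupp : ∀ s, h j s ≠ 0 → a ≤ s ∧ s ≤ b := fun s hs ↦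
    hρsupp s fun h0 ↦ hs (by simp only [hh, h0, Complex.ofReal_zero, zero_mul])
  have hbound : ∀ s, ‖h j s‖ ≤ B j := by
    intro s
    by_cases hs : a ≤ s ∧ s ≤ b
    · simp only [hh, norm_mul, Complex.norm_real, Real.norm_eq_abs]
      calc |ρ s| * ‖G (lam j * s)‖ ≤ 1 * B j :=
            mul_le_mul (hρ1 s) (hGB j hj _ (hwin s hs.1 hs.2).1 (hwin s hs.1 hs.2).2) (norm_nonneg _) zero_le_one
        _ = B j := one_mul _
    · have h0 : ρ s = 0 := by by_contra h0; exact hs (hρsupp s h0)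
      simp only [hh, h0, Complex.ofReal_zero, zero_mul, norm_zero]
      exact hB0
  exact hmain a b (Kρ * B j + lam j * K j) (B j) (Θ * lam j) le_rfl hab
    (add_nonneg (mul_nonneg hKρ hB0) (mul_nonneg hl0.le hK0)) (h j) hLip hsupp hbound M hM (Y * lam j) hYl

/-! ### §3. The dyadic instance -/

/-- The dyadic profile `θ` (`dyadicBump`) is Lipschitz (smooth with compact support). [folklore] -/
theorem exists_lipschitz_dyadicBump :
    ∃ Kθ : ℝ, 0 ≤ Kθ ∧ ∀ x y, |dyadicBump x - dyadicBump y| ≤ Kθ * |x - y| := by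
  have hcs : HasCompactSupport dyadicBump := by
    refine HasCompactSupport.intro (isCompact_Icc (a := (1 / 2 : ℝ)) (b := 2)) fun x hx ↦ ?_
    by_contra h
    exact hx (Set.Ioo_subset_Icc_self (mem_Ioo_of_dyadicBump_ne_zero h))
  obtain ⟨C, hC⟩ := (contDiff_dyadicBump (n := 1)).lipschitzWith_of_hasCompactSupport hcs (by simp)
  refine ⟨C, C.2, fun x y ↦ ?_⟩
  have h := hC.dist_le_mul x y
  rwa [Real.dist_eq, Real.dist_eq] at h

/-- **C1 over the dyadic windows of the product variable.** With `θ = dyadicBump` (support `(1/2, 2)`, Lipschitz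
constant `Kθ`), scales `λ_j = 2^j/Y` (`j < N`, `⌊M⌋² ≤ 2^N/2`, so that `Σ_{j<N} θ(m₁m₂/2^j) = 1` for all sampled
products), `M > 1`, `Y > 0`, and per-window data `B_j ≥ ‖G‖`, `K_j ≥ Lip(G)` on `[2^j/(2Y), 2^{j+1}/Y]`:
`‖Σ_{m₁,m₂≤M} (x_{m₁}/m₁)(x_{m₂}/m₂)·G(m₁m₂/Y)·e(Θm₁m₂/Y)‖ ≤ Σ_{j<N} D·X_j/(1 + log 2^j)^A` with
`X_j = (2B_j + (K′_j + 2π|Θ2^j/Y|B_j)·(3/2))(1 + |log 2|) + 2(K′_j + 2π|Θ2^j/Y|B_j)·√(2·2^j)/2^j`,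
`K′_j = KθB_j + (2^j/Y)K_j`. [cite: KowalskiMichelVanderKam2000, Prop. 5.1 p. 18 — derivation; MontgomeryVaughan2007, §8.1 (8.6)] -/
theorem norm_sum_xsq_dyadicWindows_le (A : ℕ) :
    ∃ D Kθ : ℝ, 0 < D ∧ 0 ≤ Kθ ∧ ∀ (G : ℝ → ℂ) (Θ M Y : ℝ) (N : ℕ), 1 < M → 0 < Y →
      ((⌊M⌋₊ : ℝ)) ^ 2 ≤ 2 ^ N / 2 →
      ∀ (B K : ℕ → ℝ), (∀ j ∈ Finset.range N, 0 ≤ B j ∧ 0 ≤ K j) →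
      (∀ j ∈ Finset.range N, ∀ y, 2 ^ j / Y * (1 / 2) ≤ y → y ≤ 2 ^ j / Y * 2 → ‖G y‖ ≤ B j) →
      (∀ j ∈ Finset.range N, ∀ x y, 2 ^ j / Y * (1 / 2) ≤ x → x ≤ 2 ^ j / Y * 2 →
        2 ^ j / Y * (1 / 2) ≤ y → y ≤ 2 ^ j / Y * 2 → ‖G x - G y‖ ≤ K j * |x - y|) →
        ‖∑ m₁ ∈ Icc 1 ⌊M⌋₊, ∑ m₂ ∈ Icc 1 ⌊M⌋₊,
            ((xsq M m₁ / m₁ * (xsq M m₂ / m₂) : ℝ) : ℂ) * G ((m₁ : ℝ) * m₂ / Y) *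
              (𝐞 (Θ * ((m₁ : ℝ) * m₂ / Y)) : ℂ)‖ ≤
          ∑ j ∈ Finset.range N, D * ((2 * B j +
              ((Kθ * B j + 2 ^ j / Y * K j) + 2 * π * |Θ * (2 ^ j / Y)| * B j) * (2 - 1 / 2)) *
              (1 + |Real.log 2|) +
            2 * ((Kθ * B j + 2 ^ j / Y * K j) + 2 * π * |Θ * (2 ^ j / Y)| * B j) *
              (Real.sqrt (2 * (2 : ℝ) ^ j) / (2 : ℝ) ^ j)) / (1 + Real.log ((2 : ℝ) ^ j)) ^ A := by
  obtain ⟨D, hD, hmain⟩ := norm_sum_xsq_windows_le A (a := (1 / 2 : ℝ)) (by norm_num)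
  obtain ⟨Kθ, hKθ, hθLip⟩ := exists_lipschitz_dyadicBump
  refine ⟨D, Kθ, hD, hKθ, fun G Θ M Y N hM hY hN B K hBK hGB hGLip ↦ ?_⟩
  have h := hmain (Finset.range N) (fun j ↦ (2 : ℝ) ^ j / Y) 2 Kθ dyadicBump (by norm_num) hKθ hθLip
    (fun y hy ↦ let hm := mem_Ioo_of_dyadicBump_ne_zero hy; ⟨hm.1.le, hm.2.le⟩)
    (fun y ↦ by rw [abs_of_nonneg (dyadicBump_nonneg y)]; exact dyadicBump_le_one y)
    G Θ M Y hM hY ?_ ?_ B K hBK hGB hGLip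
  · have e : ∀ j : ℕ, Y * ((2 : ℝ) ^ j / Y) = (2 : ℝ) ^ j := fun j ↦ by field_simp
    simp only [e] at h
    exact h
  · intro j _
    refine ⟨by positivity, ?_⟩
    rw [mul_div_cancel₀ _ hY.ne']
    exact one_le_pow₀ (by norm_num)
  · intro m₁ hm₁ m₂ hm₂ _
    have h1 : (1 : ℝ) ≤ (m₁ : ℝ) * m₂ := by
      have a1 : (1 : ℝ) ≤ m₁ := by exact_mod_cast (Finset.mem_Icc.1 hm₁).1
      have a2 : (1 : ℝ) ≤ m₂ := by exact_mod_cast (Finset.mem_Icc.1 hm₂).1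
      nlinarith
    have h2 : (m₁ : ℝ) * m₂ ≤ 2 ^ N / 2 := by
      have a1 : (m₁ : ℝ) ≤ ⌊M⌋₊ := by exact_mod_cast (Finset.mem_Icc.1 hm₁).2
      have a2 : (m₂ : ℝ) ≤ ⌊M⌋₊ := by exact_mod_cast (Finset.mem_Icc.1 hm₂).2
      have a0 : (0 : ℝ) ≤ m₁ := by positivity
      nlinarith
    have hp := sum_range_dyadicBump_div_two_pow h1 h2
    refine Eq.trans (Finset.sum_congr rfl fun j _ ↦ ?_) hp
    congr 1
    field_simp

end Summit.Parity.GeneralizedHardyLittlewood.Theorems.BeyondDiagonalBeatsQuarter.OffDiag
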